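import Summits.QuantumFields.YangMills.Theorems.LuscherReductionTwistedTraceScalingFloorNormalisation
import HarnessLib

/-!
# C4 INNER one-orbit: the BORN–OPPENHEIMER (Feshbach) PACKAGE and ★★★ `InnerNoIntruderOneOrbitAt L δ ⇐ InnerBOPackageAt L δ`
# (lane A of S-BASE, crux `TwistedTraceScaling` stmt-QuantumFields-20203; sub-target C4, design note `pub/ym-fleet/ym-luscher-20007-p1/COARSE-DESIGN.md` §21)

After g10 (`…FloorNormalisation`: COARSE-UPPER(L) ⇐ `InnerNoIntruderOneOrbitAt L (powScale p)` alone) lane A's only open target is the INNER one-orbit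
no-intruder bound — the Born–Oppenheimer comparison of the `L³` lattice near the orbit of the classical vacuum with the ONE-SITE model at `B' = L³β`, at
RELATIVE precision `e^{ελ_b(B')}`.  This file fixes the ARCHITECTURE of that proof as a typed reduction.  The upper (no-intruder) bound in codimension
`k` for SIGNED test functions cannot come from pointwise kernel sandwiches alone (they bound `⟨|ψ|,K|ψ|⟩`, not a min–max value); it comes from a
Feshbach (Schur-complement) splitting `ψ = u + v` of every inner test function into its projection `u = Pψ` onto the slow sector
«one-site function of the constant mode ⊗ vacuum stiff Gaussian» and the stiff-excited remainder `v = ψ − Pψ`: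

* §1 `InnerBOPackageAt L δ` — for every `k`, `ε > 0`: a β-INDEPENDENT stiff gap `θ ∈ (0,1]`, and eventually in `β` a stiff ground value `σ > 0` and an
  off-diagonal size `b` with `b² ≤ εθλ_b/16`, such that (FLOOR) `λ₀(β,L) ≥ e^{−ελ_b/4}·σ·μ₀(B')`, and every admissible inner family `G₀…G_k` splits as
  `Gᵢ = uᵢ + vᵢ` with, for all coefficient vectors `a` (`ψ_a = Σaᵢ Gᵢ`, `u_a`, `v_a` likewise): `‖u_a‖² + ‖v_a‖² ≤ ‖ψ_a‖²` (orthogonality),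
  (STIFF) `⟨v_a,Kv_a⟩ ≤ (1−θ)σμ₀‖v_a‖²`, (OFF-DIAGONAL) `⟨ψ_a,Kψ_a⟩ ≤ ⟨u_a,Ku_a⟩ + 2bσμ₀‖u_a‖‖v_a‖ + ⟨v_a,Kv_a⟩`, and (SLOW MIN–MAX) some `a ≠ 0` has
  `⟨u_a,Ku_a⟩ ≤ e^{ελ_b/4}σμ_k(B')‖u_a‖²` (`μ_j = levelValue su2Rep 1 (L³β) j`).  The projection `P`, `σ` (top value of the vacuum stiff Gaussian step ×
  gauge Gaussian), `θ` (its Mehler gap) and `b = O(β^{−1/4})` (first-order slow–stiff coupling, which has zero mean in the stiff ground state by colour-rotation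
  symmetry and therefore only enters at second order) are CONSTRUCTED in later files (design §21: product chart, Gaussian determinants, Mehler bound);
* §2 `two_mul_le_div_add_mul`, ★ `feshbach_endgame` — the real-number endgame (AM–GM on the off-diagonal term with weight `θ/2`, `endgame_a`, the floor);
* §3 ★★★ `innerNoIntruderOneOrbitAt_of_package : InnerBOPackageAt L δ → InnerNoIntruderOneOrbitAt L δ` (with `oneSiteLevels_proof`: `μ₀ > 0`,
  `μ_k ≥ (1 − θ/2)μ₀` eventually);
* §4 ★★★ `coarseNoIntruderAt_of_package_pow` — with g10's ★★★★★ `coarseNoIntruderAt_of_inner_pow`: COARSE-UPPER(L) ⇐ `InnerBOPackageAt L (powScale p)`,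
  any `p ∈ (0, 1/10)` (window `(q,r,m) = (17/20, 41/100, 11/200)` at `p = 1/40`).
HONEST FRAMING: a typed reduction (finite-dimensional Feshbach bookkeeping) for a stub of a child of the CONDITIONAL reduction route (femto rung R2b1); the package
itself (product chart of the inner region, Gaussian BO projection, Mehler gap, second-order symmetry cancellation) is OPEN; not infinite volume, not a gap, not Clay.

## References
* M. Lüscher, Nucl. Phys. B219 (1983) 233, §3 (Bloch/Born–Oppenheimer reduction to the constant modes). [Luscher1983]
* I. Schur / H. Feshbach: J. Sjöstrand, M. Zworski, Ann. Inst. Fourier 57 (2007) 2095, §2 (Schur complement / Feshbach map). [SjostrandZworski2007]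
-/

set_option autoImplicit false

noncomputable section

open MeasureTheory Filter Topology Real
open scoped BigOperators
open Literature.MathematicalPhysics.QuantumFieldTheory
open Literature.MathematicalPhysics.QuantumLattice

namespace Summit.QuantumFields.YangMills.Theorems.FemtoTransferGap

variable {L : ℕ} [NeZero L]

/-! ## §1 The Born–Oppenheimer package at one orbit -/

variable (L) in
/-- **C4 BO PACKAGE at one orbit** (`InnerBOPackageAt L δ`; OPEN, the typed content of the Born–Oppenheimer analysis near the vacuum orbit).  For every `k` and
`ε > 0` there is a stiff gap `θ ∈ (0,1]` (independent of `β`) and `β₀` such that for `β ≥ β₀` there are `σ > 0` (stiff × gauge Gaussian ground value) and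
`b ≥ 0` with `b² ≤ εθλ_b(L³β)/16` such that: `e^{−ελ_b/4}·σ·μ₀(L³β) ≤ λ₀(β,L)` (BO floor), and every family `G₀…G_k` of bounded measurable gauge-invariant
functions supported in `{orbitDist < δ(β)}` with nondegenerate Gram matrix admits raw functions `uᵢ, vᵢ` (slow projection and stiff remainder, `Gᵢ = uᵢ + vᵢ`
in `L²`) such that for all `a` (writing `ψ_a = Σaᵢ Gᵢ` etc.): `0 ≤ ‖u_a‖²`, `0 ≤ ‖v_a‖²`, `‖u_a‖² + ‖v_a‖² ≤ ‖ψ_a‖²`; `⟨v_a,K_βv_a⟩ ≤ (1−θ)σμ₀‖v_a‖²`;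
`⟨ψ_a,K_βψ_a⟩ ≤ ⟨u_a,K_βu_a⟩ + 2bσμ₀‖u_a‖‖v_a‖ + ⟨v_a,K_βv_a⟩`; and some `a ≠ 0` has `⟨u_a,K_βu_a⟩ ≤ e^{ελ_b/4}σμ_k(L³β)‖u_a‖²`.
Target text of this programme (Feshbach form of Lüscher's Born–Oppenheimer reduction), not a published theorem. -/
def InnerBOPackageAt (δ : ℝ → ℝ) : Prop :=
  ∀ k : ℕ, ∀ ε : ℝ, 0 < ε → ∃ θ : ℝ, 0 < θ ∧ θ ≤ 1 ∧ ∃ β0 : ℝ, ∀ β : ℝ, β0 ≤ β →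
    ∃ σ b : ℝ, 0 < σ ∧ 0 ≤ b ∧ b ^ 2 ≤ ε * θ * bareLambda ((L : ℝ) ^ 3 * β) / 16 ∧
      Real.exp (-(ε / 4 * bareLambda ((L : ℝ) ^ 3 * β))) * (σ * levelValue su2Rep 1 ((L : ℝ) ^ 3 * β) 0) ≤ levelValue su2Rep L β 0 ∧
      ∀ G : Fin (k + 1) → (GaugeConfig 3 L SU2 → ℝ),
        (∀ i, Measurable (G i)) → (∀ i, ∃ C : ℝ, ∀ U, |G i U| ≤ C) →
        (∀ i (g : Site 3 L → SU2) (U : GaugeConfig 3 L SU2), G i (gaugeTransform g U) = G i U) →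
        (∀ i U, G i U ≠ 0 → orbitDist U < δ β) →
        (∀ a : Fin (k + 1) → ℝ, a ≠ 0 → 0 < l2 (fun U => ∑ i, a i * G i U) (fun U => ∑ i, a i * G i U)) →
          ∃ u v : Fin (k + 1) → (GaugeConfig 3 L SU2 → ℝ),
            (∀ a : Fin (k + 1) → ℝ,
              0 ≤ l2 (fun U => ∑ i, a i * u i U) (fun U => ∑ i, a i * u i U) ∧
              0 ≤ l2 (fun U => ∑ i, a i * v i U) (fun U => ∑ i, a i * v i U) ∧
              l2 (fun U => ∑ i, a i * u i U) (fun U => ∑ i, a i * u i U) + l2 (fun U => ∑ i, a i * v i U) (fun U => ∑ i, a i * v i U) ≤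
                l2 (fun U => ∑ i, a i * G i U) (fun U => ∑ i, a i * G i U) ∧
              qform su2Rep β (fun U => ∑ i, a i * v i U) (fun U => ∑ i, a i * v i U) ≤
                (1 - θ) * (σ * levelValue su2Rep 1 ((L : ℝ) ^ 3 * β) 0) * l2 (fun U => ∑ i, a i * v i U) (fun U => ∑ i, a i * v i U) ∧
              qform su2Rep β (fun U => ∑ i, a i * G i U) (fun U => ∑ i, a i * G i U) ≤
                qform su2Rep β (fun U => ∑ i, a i * u i U) (fun U => ∑ i, a i * u i U) +
                  2 * (b * (σ * levelValue su2Rep 1 ((L : ℝ) ^ 3 * β) 0)) *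
                    Real.sqrt (l2 (fun U => ∑ i, a i * u i U) (fun U => ∑ i, a i * u i U)) *
                    Real.sqrt (l2 (fun U => ∑ i, a i * v i U) (fun U => ∑ i, a i * v i U)) +
                  qform su2Rep β (fun U => ∑ i, a i * v i U) (fun U => ∑ i, a i * v i U)) ∧
            ∃ a : Fin (k + 1) → ℝ, a ≠ 0 ∧
              qform su2Rep β (fun U => ∑ i, a i * u i U) (fun U => ∑ i, a i * u i U) ≤
                Real.exp (ε / 4 * bareLambda ((L : ℝ) ^ 3 * β)) * (σ * levelValue su2Rep 1 ((L : ℝ) ^ 3 * β) k) *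
                  l2 (fun U => ∑ i, a i * u i U) (fun U => ∑ i, a i * u i U)

/-! ## §2 The real-number endgame of the Feshbach splitting -/

/-- AM–GM with a weight: `2xy ≤ x²/s + s·y²` for `s > 0`. [folklore] -/
theorem two_mul_le_div_add_mul {x y s : ℝ} (hs : 0 < s) : 2 * x * y ≤ x ^ 2 / s + s * y ^ 2 := by
  have h : 0 ≤ (x - s * y) ^ 2 / s := by positivity
  have e : (x - s * y) ^ 2 / s = x ^ 2 / s - 2 * x * y + s * y ^ 2 := by
    field_simp
    ring
  linarith [h, e]

/-- ★ **Feshbach endgame.**  With the package data (`Q = ⟨ψ,Kψ⟩`, `Quu, Qvv` the diagonal blocks, `N ≥ Nu + Nv` the masses, `b² ≤ εθλ/16`, stiff gap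
`Qvv ≤ (1−θ)σμ₀Nv`, slow bound `Quu ≤ e^{ελ/4}σμ_k Nu`, floor `e^{−ελ/4}σμ₀ ≤ Λ₀`, `μ_k ≥ μ₀/2`, `μ_k ≥ (1−θ/2)μ₀`):
`Q·μ₀ ≤ e^{ελ}·μ_k·Λ₀·N`. [cite: SjostrandZworski2007, §2] -/
theorem feshbach_endgame {Q Quu Qvv N Nu Nv σ θ b μ0 μk lam ε Λ0 : ℝ} (hε : 0 ≤ ε) (hlam : 0 ≤ lam) (hσ : 0 ≤ σ) (hθ : 0 < θ)
    (hμ0 : 0 ≤ μ0) (hμk : μ0 / 2 ≤ μk) (hμkθ : (1 - θ / 2) * μ0 ≤ μk) (hNu : 0 ≤ Nu) (hNv : 0 ≤ Nv) (hN : Nu + Nv ≤ N)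
    (hb2 : b ^ 2 ≤ ε * θ * lam / 16) (hfloor : Real.exp (-(ε / 4 * lam)) * (σ * μ0) ≤ Λ0) (hvv : Qvv ≤ (1 - θ) * (σ * μ0) * Nv)
    (hQ : Q ≤ Quu + 2 * (b * (σ * μ0)) * Real.sqrt Nu * Real.sqrt Nv + Qvv) (huu : Quu ≤ Real.exp (ε / 4 * lam) * (σ * μk) * Nu) :
    Q * μ0 ≤ Real.exp (ε * lam) * μk * Λ0 * N := by
  have hμk0 : 0 ≤ μk := by linarith
  have hσμ0 : 0 ≤ σ * μ0 := mul_nonneg hσ hμ0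
  -- AM–GM on the off-diagonal term with weight `s = θ/2`
  have hsu : Real.sqrt Nu ^ 2 = Nu := Real.sq_sqrt hNu
  have hsv : Real.sqrt Nv ^ 2 = Nv := Real.sq_sqrt hNv
  have ham : 2 * (b * (σ * μ0)) * Real.sqrt Nu * Real.sqrt Nv ≤ σ * μ0 * (2 * b ^ 2 / θ * Nu + θ / 2 * Nv) := by
    have h := two_mul_le_div_add_mul (x := b * Real.sqrt Nu) (y := Real.sqrt Nv) (half_pos hθ)
    rw [mul_pow, hsu, hsv] at h
    have e1 : 2 * (b * (σ * μ0)) * Real.sqrt Nu * Real.sqrt Nv = σ * μ0 * (2 * (b * Real.sqrt Nu) * Real.sqrt Nv) := by ring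
    have e2 : b ^ 2 * Nu / (θ / 2) + θ / 2 * Nv = 2 * b ^ 2 / θ * Nu + θ / 2 * Nv := by
      field_simp
    rw [e1, ← e2]
    exact mul_le_mul_of_nonneg_left h hσμ0
  -- the off-diagonal coefficient: `2b²/θ ≤ ελ/8`
  have hcoef : 2 * b ^ 2 / θ ≤ ε / 8 * lam := by
    rw [div_le_iff₀ hθ]
    have := hb2
    nlinarith
  -- slow block: `e^{ελ/4} μ_k + (ε/8)λ μ₀ ≤ e^{3ελ/4} μ_k`
  have hslow : Real.exp (ε / 4 * lam) * μk + ε / 8 * lam * μ0 ≤ Real.exp (3 * ε / 4 * lam) * μk := by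
    have h1 : Real.exp (ε / 4 * lam) ≤ Real.exp (3 * ε / 4 / 2 * lam) := Real.exp_le_exp.2 (by nlinarith)
    have h2 := endgame_a (ε := 3 * ε / 4) (lam := lam) (μ0 := μ0) (μk := μk) (κ := ε / 8) (by positivity) hlam hμ0 hμk (by linarith)
    have h3 : Real.exp (ε / 4 * lam) * μk ≤ Real.exp (3 * ε / 4 / 2 * lam) * μk := mul_le_mul_of_nonneg_right h1 hμk0
    linarith
  -- stiff block: `(1 − θ/2) μ₀ ≤ e^{3ελ/4} μ_k`
  have hstiff : (1 - θ / 2) * μ0 ≤ Real.exp (3 * ε / 4 * lam) * μk := by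
    have h1 : (1 : ℝ) ≤ Real.exp (3 * ε / 4 * lam) := Real.one_le_exp (by positivity)
    nlinarith
  -- assemble `Q ≤ σ e^{3ελ/4} μ_k (Nu + Nv)`
  have hQ1 : Q ≤ σ * (Real.exp (ε / 4 * lam) * μk + 2 * b ^ 2 / θ * μ0) * Nu + σ * μ0 * (1 - θ / 2) * Nv := by
    have := hQ.trans (add_le_add (add_le_add huu ham) hvv)
    nlinarith
  have hQ2 : σ * (Real.exp (ε / 4 * lam) * μk + 2 * b ^ 2 / θ * μ0) * Nu ≤ σ * (Real.exp (3 * ε / 4 * lam) * μk) * Nu := by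
    refine mul_le_mul_of_nonneg_right (mul_le_mul_of_nonneg_left ?_ hσ) hNu
    have : 2 * b ^ 2 / θ * μ0 ≤ ε / 8 * lam * μ0 := mul_le_mul_of_nonneg_right hcoef hμ0
    linarith
  have hQ3 : σ * μ0 * (1 - θ / 2) * Nv ≤ σ * (Real.exp (3 * ε / 4 * lam) * μk) * Nv := by
    have : σ * μ0 * (1 - θ / 2) = σ * ((1 - θ / 2) * μ0) := by ring
    rw [this]
    exact mul_le_mul_of_nonneg_right (mul_le_mul_of_nonneg_left hstiff hσ) hNv
  have hM : 0 ≤ σ * (Real.exp (3 * ε / 4 * lam) * μk) := mul_nonneg hσ (mul_nonneg (Real.exp_pos _).le hμk0)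
  have hQ4 : Q ≤ σ * (Real.exp (3 * ε / 4 * lam) * μk) * N := by
    have h := hQ1.trans (add_le_add hQ2 hQ3)
    have : σ * (Real.exp (3 * ε / 4 * lam) * μk) * Nu + σ * (Real.exp (3 * ε / 4 * lam) * μk) * Nv ≤
        σ * (Real.exp (3 * ε / 4 * lam) * μk) * N := by rw [← mul_add]; exact mul_le_mul_of_nonneg_left hN hM
    exact h.trans this
  -- the floor: `σ μ₀ ≤ e^{ελ/4} Λ₀`
  have hfl : σ * μ0 ≤ Real.exp (ε / 4 * lam) * Λ0 := by
    have hpos := Real.exp_pos (ε / 4 * lam)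
    have e : Real.exp (ε / 4 * lam) * (Real.exp (-(ε / 4 * lam)) * (σ * μ0)) = σ * μ0 := by
      rw [← mul_assoc, ← Real.exp_add]; simp
    have := mul_le_mul_of_nonneg_left hfloor hpos.le
    rw [e] at this
    exact this
  have hN0 : 0 ≤ N := le_trans (add_nonneg hNu hNv) hN
  have hΛ0 : 0 ≤ Λ0 := le_trans (by positivity) hfloor
  calc Q * μ0 ≤ σ * (Real.exp (3 * ε / 4 * lam) * μk) * N * μ0 := mul_le_mul_of_nonneg_right hQ4 hμ0
    _ = Real.exp (3 * ε / 4 * lam) * μk * N * (σ * μ0) := by ring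
    _ ≤ Real.exp (3 * ε / 4 * lam) * μk * N * (Real.exp (ε / 4 * lam) * Λ0) :=
        mul_le_mul_of_nonneg_left hfl (mul_nonneg (mul_nonneg (Real.exp_pos _).le hμk0) hN0)
    _ = Real.exp (ε * lam) * μk * Λ0 * N := by
        have : Real.exp (3 * ε / 4 * lam) * Real.exp (ε / 4 * lam) = Real.exp (ε * lam) := by
          rw [← Real.exp_add]; ring_nf
        calc Real.exp (3 * ε / 4 * lam) * μk * N * (Real.exp (ε / 4 * lam) * Λ0)
            = Real.exp (3 * ε / 4 * lam) * Real.exp (ε / 4 * lam) * μk * Λ0 * N := by ring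
          _ = Real.exp (ε * lam) * μk * Λ0 * N := by rw [this]

/-! ## §3 INNER one-orbit from the package -/

/-- ★★★ **INNER NO-INTRUDER AT ONE ORBIT FROM THE BO PACKAGE**: `InnerBOPackageAt L δ → InnerNoIntruderOneOrbitAt L δ`.
[cite: Luscher1983, §3] [cite: SjostrandZworski2007, §2] -/
theorem innerNoIntruderOneOrbitAt_of_package {δ : ℝ → ℝ} (hP : InnerBOPackageAt L δ) : InnerNoIntruderOneOrbitAt L δ := by
  intro k ε hε
  have hL1 : (1 : ℝ) ≤ (L : ℝ) ^ 3 := one_le_pow₀ (by exact_mod_cast NeZero.one_le)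
  obtain ⟨C1, B0, hONE⟩ := oneSiteLevels_proof k
  obtain ⟨θ, hθ, hθ1, βP, hPk⟩ := hP k ε hε
  -- smallness scale for `λ_b`: `λ_b ≤ τ` forces `Δ_k λ_b + |C| λ_b² ≤ θ/2` and `≤ 1/2`
  set τ : ℝ := θ / (2 * (|levelGap k| + |C1| + 2)) with hτ
  have hτ0 : 0 < τ := by rw [hτ]; positivity
  refine ⟨max (max 1 B0) (max βP (2 / τ ^ 3)), fun β hβ => ?_⟩
  have hβ1 : 1 ≤ β := ((le_max_left _ _).trans (le_max_left _ _)).trans hβ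
  have hβ0 : 0 < β := by linarith
  have hβB0 : B0 ≤ β := ((le_max_right _ _).trans (le_max_left _ _)).trans hβ
  have hβP : βP ≤ β := ((le_max_left _ _).trans (le_max_right _ _)).trans hβ
  have hβτ : 2 / τ ^ 3 ≤ β := ((le_max_right _ _).trans (le_max_right _ _)).trans hβ
  intro G hGm hGb hGg hGs hGram
  -- one-site data at `B' = L³β`
  have hB'β : β ≤ (L : ℝ) ^ 3 * β := by nlinarith
  have hB'0 : 0 < (L : ℝ) ^ 3 * β := lt_of_lt_of_le hβ0 hB'β
  obtain ⟨hμ0, -, hμk⟩ := hONE ((L : ℝ) ^ 3 * β) (hβB0.trans hB'β)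
  set lam := bareLambda ((L : ℝ) ^ 3 * β) with hlamdef
  have hlam0 : 0 < lam := bareLambda_pos' hB'0
  have hlamτ : lam ≤ τ := bareLambda_cube_le (L := L) hτ0 hβτ
  have hτle : τ ≤ 1 / (2 * (|levelGap k| + |C1| + 2)) := by
    rw [hτ]; exact div_le_div_of_nonneg_right hθ1 (by positivity)
  obtain ⟨-, -, hy⟩ := smallness_of_le hlam0.le (hlamτ.trans hτle)
  have hμk' : Real.exp (-(levelGap k * lam + |C1| * lam ^ 2)) * levelValue su2Rep 1 ((L : ℝ) ^ 3 * β) 0 ≤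
      levelValue su2Rep 1 ((L : ℝ) ^ 3 * β) k := by
    refine le_trans (mul_le_mul_of_nonneg_right (Real.exp_le_exp.2 ?_) hμ0.le) hμk
    have := mul_le_mul_of_nonneg_right (le_abs_self C1) (sq_nonneg lam)
    linarith
  have hμk2 := half_le_of_exp_lower hy hμ0.le hμk'
  -- `μ_k ≥ (1 − θ/2) μ₀`
  have hyθ : levelGap k * lam + |C1| * lam ^ 2 ≤ θ / 2 := by
    have hlam1 : lam ≤ 1 := by
      have : τ ≤ 1 / (2 * 2) := hτle.trans (by
        apply div_le_div_of_nonneg_left (by norm_num) (by norm_num)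
        nlinarith [abs_nonneg (levelGap k), abs_nonneg C1])
      linarith
    have h1 : levelGap k * lam ≤ |levelGap k| * lam := mul_le_mul_of_nonneg_right (le_abs_self _) hlam0.le
    have h2 : |C1| * lam ^ 2 ≤ |C1| * lam := by
      refine mul_le_mul_of_nonneg_left ?_ (abs_nonneg _); nlinarith
    have h3 : (|levelGap k| + |C1|) * lam ≤ (|levelGap k| + |C1|) * τ := mul_le_mul_of_nonneg_left hlamτ (by positivity)
    have h4 : (|levelGap k| + |C1|) * τ ≤ θ / 2 := by
      rw [hτ]
      have hpos : 0 < 2 * (|levelGap k| + |C1| + 2) := by positivity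
      rw [mul_div_assoc', div_le_iff₀ hpos]
      nlinarith [abs_nonneg (levelGap k), abs_nonneg C1]
    linarith
  have hμkθ : (1 - θ / 2) * levelValue su2Rep 1 ((L : ℝ) ^ 3 * β) 0 ≤ levelValue su2Rep 1 ((L : ℝ) ^ 3 * β) k := by
    refine le_trans (mul_le_mul_of_nonneg_right ?_ hμ0.le) hμk'
    have := Real.add_one_le_exp (-(levelGap k * lam + |C1| * lam ^ 2))
    linarith
  -- the package at `β`
  obtain ⟨σ, b, hσ, -, hb2, hfloor, hsplit⟩ := hPk β hβP
  obtain ⟨u, v, hall, a, ha, huu⟩ := hsplit G hGm hGb hGg hGs hGram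
  obtain ⟨hNu, hNv, hN, hvv, hQ⟩ := hall a
  exact ⟨a, ha, feshbach_endgame hε.le hlam0.le hσ.le hθ hμ0.le hμk2 hμkθ hNu hNv hN hb2 hfloor hvv hQ huu⟩

/-! ## §4 COARSE-UPPER(L) from the package -/

/-- ★★★ **COARSE-UPPER(L) ⇐ the BO package at `δ = β^{−p}`** (`L ≥ 2`, any `p ∈ (0, 1/10)` in g10's window): the VERBATIM body of `CoarseNoIntruderAt L`.
[cite: Luscher1983, §3] -/
theorem coarseNoIntruderAt_of_package_pow (hL : 2 ≤ L) {p q r m : ℝ} (hp0 : 0 < p) (hp : p < 1 / 10) (hpq : 4 * p < q) (hq : q < 8 / 9)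
    (hr : 0 < r) (hr1 : 2 * r < 1) (hm : 0 < m) (hrq : 2 * r < q - m / 2) (hpm : p < m / 2) (hC : 1 + 3 * m - 3 * r < -p)
    (hP : InnerBOPackageAt L (powScale p)) :
    ∀ k : ℕ, ∀ d : ℝ, d < levelGap k → ∃ lam0 : ℝ, 0 < lam0 ∧ ∀ lam : ℝ, 0 < lam → lam ≤ lam0 →
      ∀ β : ℝ, InFemtoWindow lam β L →
        levelValue su2Rep L β k ≤ Real.exp (-(d * luscherLambda β L) / L) * levelValue su2Rep L β 0 :=
  coarseNoIntruderAt_of_inner_pow hL hp0 hp hpq hq hr hr1 hm hrq hpm hC (innerNoIntruderOneOrbitAt_of_package hP)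

/-- The instance of record: `p = 1/40` with `(q,r,m) = (17/20, 41/100, 11/200)`. [cite: Luscher1983, §3] -/
theorem coarseNoIntruderAt_of_package_fortieth (hL : 2 ≤ L) (hP : InnerBOPackageAt L (powScale (1 / 40))) :
    ∀ k : ℕ, ∀ d : ℝ, d < levelGap k → ∃ lam0 : ℝ, 0 < lam0 ∧ ∀ lam : ℝ, 0 < lam → lam ≤ lam0 →
      ∀ β : ℝ, InFemtoWindow lam β L →
        levelValue su2Rep L β k ≤ Real.exp (-(d * luscherLambda β L) / L) * levelValue su2Rep L β 0 := by
  obtain ⟨h1, h2, h3, h4, h5, h6, h7, h8, h9, h10⟩ := innerPow_window_nonempty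
  exact coarseNoIntruderAt_of_package_pow hL h1 h2 h3 h4 h5 h6 h7 h8 h9 h10 hP

end Summit.QuantumFields.YangMills.Theorems.FemtoTransferGap

end
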